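import Literature.Computability.Complexity.DegreeThreeEncodingPerfect
import Literature.Computability.Complexity.PolynomialEntropyApproximation
import Mathlib.Tactic.LinearCombination
import HarnessLib

/-!
# Randomizing polynomials VI: entropy of a perfect extension and the reduced `PEA` instance

A perfect extension with `m` fresh variables raises the output entropy of a sparse polynomial map by
exactly `m` bits: `H(P'(U_{n+m})) = H(P(U_n)) + m` [Dvir–Gutfreund–Rothblum–Vadhan 2010, proof of
Thm 4.6 ("`H(p̂(U)) = H(p(U)) + |r|` for a perfect encoding"); Allender et al. 2025, Lemma 10].  In
fibre terms: the fibre of `P'` through `x'` is in bijection with the fibre of `P` through the prefix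
of `x'` (`card_fiber_eq_of_perfExt`), and a map on a product space whose fibres have the sizes of
the fibres of a map on the first factor has entropy shifted by `log₂` of the size of the second
factor (`mapEntropy_eq_add_of_card_fiber`).

* `valOf`, `natOf`, `toFinMap` (passage between `Fin n`-indexed `PolyMapF2 n` and the ℕ-indexed
  lists of files III–V) with `eval_eq_evalM`, `natOf_toFinMap`;
* `entropy_toFinMap_of_perfExt`: `H = H(P) + m`;
* `reduceInst I` — the reduced instance `(n + m, P', k + m)` of a `PEA` instance `(n, P, k)` —
  with `degLE_reduceInst` (degree `≤ 3`), `entropy_reduceInst`, and the membership transfer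
  `reduceInst_mem_yes` / `reduceInst_mem_no` (`PEA_d`-yes ↦ `PEA_3`-yes, no ↦ no, for every `d`).

## References

* Z. Dvir, D. Gutfreund, G. N. Rothblum, S. Vadhan, ECCC TR10-160 (2010), Thm 4.5–4.6.
* T. Cover, J. Thomas, *Elements of Information Theory*, 2nd ed., §2.1 (grouping by fibres).
-/

namespace Literature.Computability.Complexity

namespace RandPoly

open Finset
open Literature.InformationTheory.Entropy (fiber mem_fiber card_fiber_pos mapEntropy)

/-! ### Entropy of a map on a product whose fibres have the sizes of the fibres of a factor map -/

/-- **Entropy shift.** If `F : ι × κ → β'` has, through every point `(x, r)`, a fibre of the same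
size as the fibre of `f : ι → β` through `x`, then `H(F(U)) = H(f(U)) + log₂ |κ|`.
[cite: DvirGutfreundRothblumVadhan2010, Thm 4.6 (proof)] -/
theorem mapEntropy_eq_add_of_card_fiber {ι κ β β' : Type*} [Fintype ι] [Fintype κ] [Nonempty ι]
    [Nonempty κ] [DecidableEq β] [DecidableEq β'] (F : ι × κ → β') (f : ι → β)
    (h : ∀ x r, (fiber univ F (F (x, r))).card = (fiber univ f (f x)).card) :
    mapEntropy univ F = mapEntropy univ f + Real.logb 2 (Fintype.card κ) := by
  have hι : (0 : ℝ) < Fintype.card ι := Nat.cast_pos.2 Fintype.card_pos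
  have hκ : (0 : ℝ) < Fintype.card κ := Nat.cast_pos.2 Fintype.card_pos
  have hterm : ∀ p : ι × κ,
      Real.logb 2 (((univ : Finset (ι × κ)).card : ℝ) / (fiber univ F (F p)).card) =
        Real.logb 2 (((univ : Finset ι).card : ℝ) / (fiber univ f (f p.1)).card) +
          Real.logb 2 (Fintype.card κ) := by
    rintro ⟨x, r⟩
    have hf : (0 : ℝ) < (fiber univ f (f x)).card := Nat.cast_pos.2 (card_fiber_pos f (mem_univ x))
    rw [h x r, Finset.card_univ, Fintype.card_prod, Nat.cast_mul, Finset.card_univ, mul_comm,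
      mul_div_assoc, Real.logb_mul hκ.ne' (div_pos hι hf).ne', add_comm]
  unfold mapEntropy
  rw [Finset.sum_congr rfl fun p _ => hterm p, Finset.sum_add_distrib, Finset.sum_const]
  have hsum : ∑ p : ι × κ, Real.logb 2 (((univ : Finset ι).card : ℝ) / (fiber univ f (f p.1)).card) =
      (Fintype.card κ : ℝ) * ∑ x, Real.logb 2 (((univ : Finset ι).card : ℝ) / (fiber univ f (f x)).card) := by
    rw [← Finset.univ_product_univ, Finset.sum_product]
    simp only [Finset.sum_const, Finset.card_univ, nsmul_eq_mul]
    rw [Finset.mul_sum]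
  rw [hsum]
  simp only [Finset.card_univ, Fintype.card_prod, Nat.cast_mul, nsmul_eq_mul]
  field_simp

/-! ### Between `Fin n`-indexed and ℕ-indexed sparse maps -/

variable {n : ℕ}

/-- The valuation of a bit vector (`0` beyond its length). [folklore] -/
def valOf (x : Fin n → ZMod 2) : ℕ → ZMod 2 := fun i => if h : i < n then x ⟨i, h⟩ else 0

/-- The ℕ-indexed presentation of a `Fin n`-indexed sparse map. [folklore] -/
def natOf (P : PolyMapF2 n) : List (List (List ℕ)) := P.map (List.map (List.map Fin.val))

/-- The `Fin n`-indexed presentation of an ℕ-indexed sparse map with variables below `n`. [folklore] -/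
def toFinMap (n : ℕ) (O : List (List (List ℕ))) (h : VarsIn (fun x => x < n) O) : PolyMapF2 n :=
  O.pmap (fun q hq => q.pmap (fun μ hμ => μ.pmap Fin.mk hμ) hq) h

/-- `valOf x` reads the coordinates of `x`. [folklore] -/
@[simp] theorem valOf_val (x : Fin n → ZMod 2) (i : Fin n) : valOf x i.val = x i := by
  simp [valOf, i.isLt]

/-- **Evaluation is evaluation of the ℕ-indexed presentation at the valuation.** [folklore] -/
theorem eval_eq_evalM (P : PolyMapF2 n) (x : Fin n → ZMod 2) : P.eval x = evalM (valOf x) (natOf P) := by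
  simp [PolyMapF2.eval, evalM, evalP, natOf, Function.comp_def]

/-- The variables of `natOf P` are below `n`. [folklore] -/
theorem varsIn_natOf (P : PolyMapF2 n) : VarsIn (fun x => x < n) (natOf P) := by
  intro q hq μ hμ x hx
  simp only [natOf, List.mem_map] at hq
  obtain ⟨p, -, rfl⟩ := hq
  obtain ⟨μ', -, rfl⟩ := List.mem_map.1 hμ
  obtain ⟨i, -, rfl⟩ := List.mem_map.1 hx
  exact i.isLt

/-- `Fin.val` inverts `Fin.mk` on a monomial. [folklore] -/
theorem map_val_pmap_mk : ∀ (μ : List ℕ) (h : ∀ x ∈ μ, x < n), (μ.pmap Fin.mk h).map Fin.val = μ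
  | [], _ => rfl
  | x :: μ, h => by
    show x :: (μ.pmap Fin.mk _).map Fin.val = x :: μ
    rw [map_val_pmap_mk μ]

/-- `Fin.val` inverts `Fin.mk` on a polynomial. [folklore] -/
theorem map_val_pmap_mk₂ : ∀ (q : List (List ℕ)) (h : ∀ μ ∈ q, ∀ x ∈ μ, x < n),
    (q.pmap (fun μ hμ => μ.pmap Fin.mk hμ) h).map (List.map Fin.val) = q
  | [], _ => rfl
  | μ :: q, h => by
    show (μ.pmap Fin.mk _).map Fin.val :: (q.pmap (fun μ hμ => μ.pmap Fin.mk hμ) _).map (List.map Fin.val)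
      = μ :: q
    rw [map_val_pmap_mk, map_val_pmap_mk₂ q]

/-- `natOf` inverts `toFinMap`. [folklore] -/
theorem natOf_toFinMap (n : ℕ) : ∀ (O : List (List (List ℕ))) (h : VarsIn (fun x => x < n) O),
    natOf (toFinMap n O h) = O
  | [], _ => rfl
  | q :: O, h => by
    show (q.pmap (fun μ hμ => μ.pmap Fin.mk hμ) _).map (List.map Fin.val) ::
        natOf (toFinMap n O fun q' hq' => h q' (List.mem_cons_of_mem _ hq')) = q :: O
    rw [map_val_pmap_mk₂, natOf_toFinMap n O]

/-- Monomials of `toFinMap` are the monomials of `O` (with the same lengths). [folklore] -/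
theorem mem_toFinMap {O : List (List (List ℕ))} {h : VarsIn (fun x => x < n) O} {p : List (List (Fin n))}
    (hp : p ∈ toFinMap n O h) {μ : List (Fin n)} (hμ : μ ∈ p) :
    ∃ q ∈ O, ∃ ν ∈ q, μ.map Fin.val = ν := by
  have h1 : natOf (toFinMap n O h) = O := natOf_toFinMap n O h
  refine ⟨p.map (List.map Fin.val), ?_, μ.map Fin.val, List.mem_map.2 ⟨μ, hμ, rfl⟩, rfl⟩
  rw [← h1]
  exact List.mem_map.2 ⟨p, hp, rfl⟩

/-! ### Entropy of a perfect extension -/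

/-- The valuation of an appended vector agrees with the valuation of the prefix below `n`. [folklore] -/
theorem valOf_append_of_lt {m : ℕ} (y : Fin n → ZMod 2) (s : Fin m → ZMod 2) {i : ℕ} (hi : i < n) :
    valOf (Fin.append y s) i = y ⟨i, hi⟩ := by
  rw [valOf, dif_pos (by omega)]
  exact Fin.append_left y s ⟨i, hi⟩

/-- The valuation of an appended vector on the second block. [folklore] -/
theorem valOf_append_add {m : ℕ} (y : Fin n → ZMod 2) (s : Fin m → ZMod 2) (j : Fin m) :
    valOf (Fin.append y s) (n + j.val) = s j := by
  rw [valOf, dif_pos (by omega)]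
  exact Fin.append_right y s j

/-- Appended vectors agree below `n` exactly through their prefixes. [folklore] -/
theorem agreeBelow_valOf_append {m : ℕ} (y : Fin n → ZMod 2) (s s' : Fin m → ZMod 2) :
    AgreeBelow n (valOf (Fin.append y s)) (valOf (Fin.append y s')) := fun i hi => by
  rw [valOf_append_of_lt y s hi, valOf_append_of_lt y s' hi]

/-- The value of a `Fin n`-indexed map at a prefix. [folklore] -/
theorem evalM_valOf_append {m : ℕ} (P : PolyMapF2 n) (y : Fin n → ZMod 2) (s : Fin m → ZMod 2) :
    evalM (valOf (Fin.append y s)) (natOf P) = P.eval y := by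
  rw [eval_eq_evalM]
  exact evalM_congr_of_varsIn (varsIn_natOf P) fun x hx => by
    rw [valOf_append_of_lt y s hx, valOf, dif_pos hx]

/-- **Fibres of a perfect extension**: for `P' = toFinMap (n+m) O`, `O` a perfect extension of
`evalM · (natOf P)` with fresh variables `[n, n+m)`, the fibre of `P' ∘ append` through `(x, r)` has
the size of the fibre of `P` through `x`. [cite: DvirGutfreundRothblumVadhan2010, Thm 4.6 (proof)] -/
theorem card_fiber_eq_of_perfExt {m : ℕ} (P : PolyMapF2 n) {O : List (List (List ℕ))}
    (hO : VarsIn (fun x => x < n + m) O) (hPE : PerfExt n (n + m) O (fun v => evalM v (natOf P)))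
    (x : Fin n → ZMod 2) (r : Fin m → ZMod 2) :
    (fiber univ ((toFinMap (n + m) O hO).eval ∘ Fin.appendEquiv n m)
        (((toFinMap (n + m) O hO).eval ∘ Fin.appendEquiv n m) (x, r))).card =
      (fiber univ P.eval (P.eval x)).card := by
  set P' := toFinMap (n + m) O hO with hP'
  have hev : ∀ (y : Fin n → ZMod 2) (s : Fin m → ZMod 2),
      (P'.eval ∘ Fin.appendEquiv n m) (y, s) = evalM (valOf (Fin.append y s)) O := by
    intro y s
    show P'.eval (Fin.append y s) = _
    rw [eval_eq_evalM, hP', natOf_toFinMap]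
  refine Finset.card_bij (fun (a : (Fin n → ZMod 2) × (Fin m → ZMod 2)) _ => a.1) (fun a ha => ?_)
    (fun a₁ ha₁ a₂ ha₂ heq => ?_) (fun y hy => ?_)
  · -- into the fibre of `P`: decodability
    obtain ⟨y, s⟩ := a
    rw [mem_fiber] at ha ⊢
    refine ⟨mem_univ _, ?_⟩
    have h1 := hPE.dec (valOf (Fin.append y s)) (valOf (Fin.append x r)) (by rw [← hev, ← hev]; exact ha.2)
    rwa [evalM_valOf_append, evalM_valOf_append] at h1
  · -- injective: same prefix and same outputs force the same fresh block
    obtain ⟨y₁, s₁⟩ := a₁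
    obtain ⟨y₂, s₂⟩ := a₂
    simp only at heq
    subst heq
    rw [mem_fiber] at ha₁ ha₂
    have he : evalM (valOf (Fin.append y₁ s₁)) O = evalM (valOf (Fin.append y₁ s₂)) O := by
      rw [← hev, ← hev, ha₁.2, ha₂.2]
    have hag := hPE.inj _ _ (agreeBelow_valOf_append y₁ s₁ s₂) he
    refine Prod.ext rfl (funext fun j => ?_)
    have := hag (n + j.val) (by omega)
    rwa [valOf_append_add, valOf_append_add] at this
  · -- surjective: range
    rw [mem_fiber] at hy
    have ht : evalM (valOf (Fin.append x r)) (natOf P) = evalM (valOf (Fin.append y r)) (natOf P) := by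
      rw [evalM_valOf_append, evalM_valOf_append, hy.2]
    obtain ⟨u, huw, hue⟩ := hPE.range _ _ ht
    refine ⟨(y, fun j => u (n + j.val)), ?_, rfl⟩
    rw [mem_fiber]
    refine ⟨mem_univ _, ?_⟩
    rw [hev, hev, ← hue]
    refine evalM_congr_of_varsIn hO fun i hi => ?_
    by_cases hin : i < n
    · rw [valOf_append_of_lt y _ hin, ← valOf_append_of_lt y r hin]
      exact (huw i hin).symm
    · obtain ⟨j, rfl⟩ : ∃ j, i = n + j := ⟨i - n, by omega⟩
      exact valOf_append_add y (fun j => u (n + j.val)) ⟨j, by omega⟩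

/-- **Entropy of a perfect extension**: `H(P'(U_{n+m})) = H(P(U_n)) + m`.
[cite: DvirGutfreundRothblumVadhan2010, Thm 4.6 (proof)] -/
theorem entropy_toFinMap_of_perfExt {m : ℕ} (P : PolyMapF2 n) {O : List (List (List ℕ))}
    (hO : VarsIn (fun x => x < n + m) O) (hPE : PerfExt n (n + m) O (fun v => evalM v (natOf P))) :
    (toFinMap (n + m) O hO).entropy = P.entropy + m := by
  unfold PolyMapF2.entropy
  rw [← mapEntropy_univ_comp_equiv (Fin.appendEquiv n m),
    mapEntropy_eq_add_of_card_fiber _ P.eval (card_fiber_eq_of_perfExt P hO hPE)]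
  congr 1
  rw [Fintype.card_fun, ZMod.card, Fintype.card_fin, Nat.cast_pow, Nat.cast_ofNat,
    Real.logb_pow, Real.logb_self_eq_one (by norm_num), mul_one]

/-! ### The reduced instance -/

/-- The number of fresh variables of the reduction of `(n, P)`. [cite: DvirGutfreundRothblumVadhan2010, Thm 4.5] -/
def freshOf (I : PEAInst) : ℕ := (encodeMap I.1 (natOf I.2.1)).1 - I.1

/-- The variables of the encoding of `(n, P)` are below `n + fresh`. [folklore] -/
theorem varsIn_encodeMap_natOf (I : PEAInst) :
    VarsIn (fun x => x < I.1 + freshOf I) (encodeMap I.1 (natOf I.2.1)).2 := by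
  have hle := le_encodeMap_fst I.1 (natOf I.2.1)
  refine (varsIn_encodeMap I.1 (natOf I.2.1)).mono fun x hx => ?_
  unfold freshOf
  rcases hx with ⟨q, hq, T, hT, hxT⟩ | hx
  · have := varsIn_natOf I.2.1 q hq T hT x hxT; omega
  · omega

/-- **The reduced instance** `(n + m, P', k + m)`: `P'` the degree-3 encoding of `P` with `m` fresh
variables, the threshold shifted by `m`. [cite: DvirGutfreundRothblumVadhan2010, Thm 4.5] -/
def reduceInst (I : PEAInst) : PEAInst :=
  ⟨I.1 + freshOf I, (toFinMap (I.1 + freshOf I) (encodeMap I.1 (natOf I.2.1)).2 (varsIn_encodeMap_natOf I),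
    I.2.2 + freshOf I)⟩

/-- **The reduced instance has degree `≤ 3`.** [cite: DvirGutfreundRothblumVadhan2010, Thm 4.5] -/
theorem degLE_reduceInst (I : PEAInst) : PolyMapF2.DegLE 3 (reduceInst I).2.1 := by
  intro p hp μ hμ
  obtain ⟨q, hq, ν, hν, hμν⟩ := mem_toFinMap hp hμ
  have := length_le_three_encodeMap I.1 (natOf I.2.1) hq hν
  rw [← hμν, List.length_map] at this
  exact this

/-- **Entropy of the reduced instance**: `H(P') = H(P) + m`. [cite: DvirGutfreundRothblumVadhan2010, Thm 4.5–4.6] -/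
theorem entropy_reduceInst (I : PEAInst) :
    PolyMapF2.entropy (reduceInst I).2.1 = PolyMapF2.entropy I.2.1 + freshOf I := by
  have hPE := perfExt_encodeMap I.1 (natOf I.2.1) (varsIn_natOf I.2.1)
  have heq : (encodeMap I.1 (natOf I.2.1)).1 = I.1 + freshOf I := by
    have := le_encodeMap_fst I.1 (natOf I.2.1); unfold freshOf; omega
  rw [heq] at hPE
  exact entropy_toFinMap_of_perfExt I.2.1 (varsIn_encodeMap_natOf I) hPE

/-- **Yes-instances of `PEA_d` reduce to yes-instances of `PEA_3`** (indeed of every `PEA_{d'}`,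
`d' ≥ 3`; the degree promise on the input is not used). [cite: DvirGutfreundRothblumVadhan2010, Thm 4.5] -/
theorem reduceInst_mem_yes {d : ℕ} {I : PEAInst} (hI : PEAInst.encoding.encode I ∈ (PEA d).yes) :
    PEAInst.encoding.encode (reduceInst I) ∈ (PEA 3).yes := by
  rw [encode_mem_PEA_yes_iff] at hI ⊢
  refine ⟨degLE_reduceInst I, ?_⟩
  rw [entropy_reduceInst]
  have : ((reduceInst I).2.2 : ℝ) = I.2.2 + freshOf I := by simp [reduceInst]
  rw [this]
  linarith [hI.2]

/-- **No-instances of `PEA_d` reduce to no-instances of `PEA_3`.** [cite: DvirGutfreundRothblumVadhan2010, Thm 4.5] -/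
theorem reduceInst_mem_no {d : ℕ} {I : PEAInst} (hI : PEAInst.encoding.encode I ∈ (PEA d).no) :
    PEAInst.encoding.encode (reduceInst I) ∈ (PEA 3).no := by
  rw [encode_mem_PEA_no_iff] at hI ⊢
  refine ⟨degLE_reduceInst I, ?_⟩
  rw [entropy_reduceInst]
  have : ((reduceInst I).2.2 : ℝ) = I.2.2 + freshOf I := by simp [reduceInst]
  rw [this]
  linarith [hI.2]

end RandPoly

end Literature.Computability.Complexity
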